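import Literature.InformationTheory.QuantumCodes.AlphaPercolationThreshold
import Mathlib.Topology.Order.IntermediateValue
import Mathlib.Analysis.SpecialFunctions.Pow.Continuity
import HarnessLib

/-!
# `α`-percolation in the INDEPENDENT error model: Fawzi–Grospellier–Leverrier 2018, Theorem 17 eq. (probiid)
# and Lemma 29 (the threshold `p_iid`) — PROOF

Index of sources: `[cite: FawziGrospellierLeverrier2018]` = O. Fawzi, A. Grospellier, A. Leverrier, "Efficient decoding
of random errors for quantum expander codes", STOC 2018 / arXiv:1711.08351v2: Thm 17 (§4, p0013 L7-35), its second
clause eq. (probiid) (p0013 L25-31) and the discussion of `p_iid` (p0013 L33-35); App. §7.2 "Proof of Eq. (probiid)"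
(p0019 L78 – p0020 L50), eq. (alpha=1) (p0020 L22-26), Lemma 26 (Chernoff bound, p0019 L31-36), Lemma 29 (p0020 L52-66).

qec PARTITION v2 row 04 (`prover-qec-type-04`, gen 5), item 04.IID. The named fact `FGL18_theorem17`
(`QuantumExpanderCodes.lean`, discharged by `FGL18_theorem17_holds` in `AlphaPercolationThreshold.lean`) types the
LOCAL STOCHASTIC clause of Theorem 17 and records "(The i.i.d. refinement eq. (probiid) is not typed.)". This file
proves that refinement, for the tree's independent model `bernoulliWeight p` (`ClusterCountingBound.lean`, FGL18 Def 7),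
following the printed appendix proof line by line:

* `card_boundary_add_le` — **`|∂X| ≤ (d-2)|X| + 2`** for a nonempty connected `X` (`∂X = Γ(X) ∖ X`, written
  `(X.biUnion Γ) \ X`; "by induction on the size `|X|`": grow `X` along the cut-connectivity of the tree's
  `IsGraphConnected`, one adjacent vertex at a time);
* `exists_alphaCluster_boundary_disjoint` — the **closure step**: a connected `α`-subset of maximal cardinality has no
  error on its boundary ("repeatedly adding vertices in `∂X ∩ E`"; needs `α ≤ 1`);
* `sum_bernoulliWeight_filter_inter_eq`, `sum_bernoulliWeight_filter_subset_disjoint`,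
  `sum_bernoulliWeight_alphaSubset_disjoint` — **cylinder events** under the Bernoulli weight: `P[E ∩ S = T] =
  p^|T|(1-p)^{|S|-|T|}`, hence the EXACT weight `(1-p)^{|∂X|} Σ_{m ≥ α|X|} C(|X|,m) p^m (1-p)^{|X|-m}` of
  "`|X ∩ E| ≥ α|X|` and `∂X ∩ E = ∅`";
* `sum_connected_pow_mul_pow_boundary_le_one` — **eq. (alpha=1)**: `Σ_{X ∋ v connected} p^|X| (1-p)^{|∂X|} ≤ 1`
  (the events "`X` is exactly the connected component of `v` in `E`" are pairwise disjoint — uniqueness of the component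
  via cut-connectivity — and the Bernoulli weights sum to `1`);
* `binomial_tail_le_chernoff`, `chernoff_base_eq` — **Lemma 26** in closed form:
  `Σ_{m ≥ αs} C(s,m)p^m(1-p)^{s-m} ≤ ((p/α)^α((1-p)/(1-α))^{1-α})^s = (p^α (1-p)^{1-α} e^{h(α)})^s` for `0 < p ≤ α ≤ 1`
  (exponential tilting to the `Bernoulli(α)` law);
* `fgl18_theorem17_iid` — **Theorem 17, eq. (probiid)**: for a graph of degree `≤ d` (`d ≥ 3`), `α ∈ (0,1]`, `t ≥ 1`,
  `0 < p < α/(d-1)` and `q < 1`, `P_iid[MaxConn_α(E) ≥ t] ≤ |V|((d-1)/(d-2))² q^t/(1-q)` with the printed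
  `q = (1-p)^{d-1-α} p^α 2^{h(α)} (d-1)(1+1/(d-2))^{d-2}` (natural-log form `2^{h(α)} = e^{binEntropy α}`, as in
  `percolationValue`); the union bound is taken over `X ∈ 𝒞_s(𝒢)` and eq. (alpha=1) is summed over `v`
  (`sum_connectedOfCard_pow_mul_pow_boundary_le_card`), which is the printed `Σ_{s ≥ t} Σ_{v ∈ V}`;
* `fgl18_lemma29_strictMonoOn`, `fgl18_lemma29_endpoint`, `fgl18_lemma29` — **Lemma 29**: `q` is increasing on
  `[0, α/(d-1)]` (strictly; via `log x ≥ 1 - 1/x` and `log x < x - 1` instead of the derivative), `q(0) = 0`,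
  `q(α/(d-1)) = (d-1-α)^{d-1-α}/((d-2)^{d-2}(1-α)^{1-α}) ≥ 1`, hence (intermediate value theorem) a `p_iid ∈
  [p_ls, α/(d-1)]` with `q(p_iid) = 1` and `q(p) < 1` for every `0 ≤ p < p_iid` (`p_iid ≥ p_ls` because
  `q(p) ≤ (p/p_ls)^α`);
* `fgl18_theorem17_iid_threshold` — the two combined: below `p_iid` the i.i.d. bound holds with `q < 1` on every graph
  of degree `≤ d`.

All statements PROVED (kernel axioms); no definitions (the boundary is spelled out as `(X.biUnion Γ) \ X`), no new
named facts, no `native_decide`. The side condition `q < 1` of `fgl18_theorem17_iid` is implicit in print ("if `p` is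
chosen small enough so that `q < 1`"); without it the displayed right-hand side is not a bound. Not here: Prop. 30
(the matching lower bound on trees) and any numerical value of `p_iid` (the text's `p_iid - p_ls ≈ 10^{-27}` for its
parameters is a remark, §5 p0017).
-/

namespace Literature.InformationTheory.QuantumCodes

open Finset Real Literature.Probability.LatticeModels

/-! ### The vertex boundary `∂X = Γ(X) ∖ X` of a connected set -/

section Boundary

variable {V : Type*} [Fintype V] [DecidableEq V] {G : SimpleGraph V} [DecidableRel G.Adj]

/-- Membership in the vertex boundary `∂X = Γ(X) ∖ X` (written `(X.biUnion Γ) \ X`): `u ∉ X` and `u` has a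
neighbour in `X`. [cite: FawziGrospellierLeverrier2018, §7.2 proof of eq. (probiid) ("∂X = Γ(X) ∖ X, the boundary of X"; arXiv v2 p0019)] -/
theorem mem_vertexBoundary_iff {X : Finset V} {u : V} :
    u ∈ (X.biUnion fun x => G.neighborFinset x) \ X ↔ u ∉ X ∧ ∃ x ∈ X, G.Adj x u := by
  simp only [Finset.mem_sdiff, Finset.mem_biUnion, SimpleGraph.mem_neighborFinset]
  tauto

/-- **`|∂X| ≤ (d-2)|X| + 2`** for a nonempty connected `X` in a graph of degree `≤ d`, in the subtraction-free
form `|∂X| + 2|X| ≤ d|X| + 2` ("by induction on the size `|X|`": grow `X` one adjacent vertex at a time — the new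
vertex leaves the boundary and brings at most `d - 1` new boundary vertices).
[cite: FawziGrospellierLeverrier2018, §7.2 proof of eq. (probiid) ("|∂X| ≤ (d-2)|X| + 2"; arXiv v2 p0020 L1)] -/
theorem card_boundary_add_le {d : ℕ} (hdeg : ∀ v, G.degree v ≤ d) {X : Finset V}
    (hconn : IsGraphConnected G X) (hne : X.Nonempty) :
    ((X.biUnion fun x => G.neighborFinset x) \ X).card + 2 * X.card ≤ d * X.card + 2 := by
  classical
  -- growing prefixes `A ⊆ X` of every size `k ≤ |X|` with `|∂A| + 2k ≤ dk + 2`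
  have key : ∀ k, 1 ≤ k → k ≤ X.card → ∃ A ⊆ X, A.card = k ∧
      ((A.biUnion fun x => G.neighborFinset x) \ A).card + 2 * k ≤ d * k + 2 := by
    intro k hk
    induction k, hk using Nat.le_induction with
    | base =>
      intro _
      obtain ⟨x₀, hx₀⟩ := hne
      refine ⟨{x₀}, Finset.singleton_subset_iff.2 hx₀, Finset.card_singleton x₀, ?_⟩
      have h1 : (({x₀} : Finset V).biUnion fun x => G.neighborFinset x) \ {x₀} ⊆ G.neighborFinset x₀ := by
        intro u hu
        rw [Finset.mem_sdiff, Finset.singleton_biUnion] at hu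
        exact hu.1
      have h2 := (Finset.card_le_card h1).trans ((G.card_neighborFinset_eq_degree x₀).le.trans (hdeg x₀))
      omega
    | succ k hk ih =>
      intro hkX
      obtain ⟨A, hAX, hAcard, hAbd⟩ := ih (Nat.le_of_succ_le hkX)
      have hAne : A.Nonempty := by rw [← Finset.card_pos, hAcard]; exact hk
      have hXA : (X \ A).Nonempty := by
        rw [← Finset.card_pos, Finset.card_sdiff_of_subset hAX]
        omega
      obtain ⟨a, ha, b, hb, hab⟩ := hconn A hAX hAne hXA
      rw [Finset.mem_sdiff] at hb
      refine ⟨insert b A, Finset.insert_subset hb.1 hAX,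
        by rw [Finset.card_insert_of_notMem hb.2, hAcard], ?_⟩
      set bdA := (A.biUnion fun x => G.neighborFinset x) \ A with hbdA
      set bdA' := ((insert b A).biUnion fun x => G.neighborFinset x) \ insert b A with hbdA'
      have hb_bd : b ∈ bdA := by
        rw [hbdA, mem_vertexBoundary_iff]; exact ⟨hb.2, a, ha, hab⟩
      have ha_nb : a ∈ G.neighborFinset b := by
        rw [SimpleGraph.mem_neighborFinset]; exact hab.symm
      have hsub : bdA' ⊆ bdA.erase b ∪ (G.neighborFinset b).erase a := by
        intro u hu
        rw [hbdA', mem_vertexBoundary_iff] at hu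
        obtain ⟨huA', x, hx, hxu⟩ := hu
        rw [Finset.mem_insert, not_or] at huA'
        rw [Finset.mem_union]
        rcases Finset.mem_insert.1 hx with rfl | hxA
        · right
          rw [Finset.mem_erase, SimpleGraph.mem_neighborFinset]
          exact ⟨fun h => huA'.2 (h ▸ ha), hxu⟩
        · left
          rw [Finset.mem_erase, hbdA, mem_vertexBoundary_iff]
          exact ⟨huA'.1, huA'.2, x, hxA, hxu⟩
      have hcard : bdA'.card + 2 ≤ bdA.card + d := by
        have h1 := Finset.card_le_card hsub
        have h2 := Finset.card_union_le (bdA.erase b) ((G.neighborFinset b).erase a)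
        have h3 := Finset.card_erase_of_mem hb_bd
        have h4 := Finset.card_erase_of_mem ha_nb
        have h5 : (G.neighborFinset b).card ≤ d := (G.card_neighborFinset_eq_degree b).le.trans (hdeg b)
        have h6 : 0 < bdA.card := Finset.card_pos.2 ⟨b, hb_bd⟩
        have h7 : 0 < (G.neighborFinset b).card := Finset.card_pos.2 ⟨a, ha_nb⟩
        omega
      have hAbd' : bdA.card + 2 * k ≤ d * k + 2 := hAbd
      have : bdA'.card + 2 * (k + 1) ≤ d * (k + 1) + 2 := by
        have e1 : d * (k + 1) = d * k + d := by ring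
        omega
      exact this
  obtain ⟨A, hAX, hAcard, hAbd⟩ := key X.card (Finset.card_pos.2 hne) le_rfl
  have hAeq : A = X := Finset.eq_of_subset_of_card_le hAX hAcard.ge
  rw [hAeq] at hAbd
  exact hAbd

omit [Fintype V] [DecidableRel G.Adj] in
/-- Adding a vertex adjacent to a connected set keeps it connected (cut form of `IsGraphConnected`); the same
elementary fact as `Literature/Barriers/CriticalPhenomena/PositionSpaceRGNonGibbsianTorusTopology.isGraphConnected_insert`,
re-proved here to keep the import graph topical. [folklore] -/
private theorem isGraphConnected_insert_of_adj {X : Finset V} (hX : IsGraphConnected G X) {x u : V}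
    (hx : x ∈ X) (hxu : G.Adj x u) : IsGraphConnected G (insert u X) := by
  classical
  by_cases hu : u ∈ X
  · rwa [Finset.insert_eq_of_mem hu]
  intro A hA hAne hcne
  by_cases huA : u ∈ A
  · by_cases hAX : (A ∩ X).Nonempty
    · -- cut `X` along `A ∩ X`
      have hsub : A ∩ X ⊆ X := Finset.inter_subset_right
      have hc : (X \ (A ∩ X)).Nonempty := by
        obtain ⟨c, hc⟩ := hcne
        rw [Finset.mem_sdiff, Finset.mem_insert] at hc
        rcases hc.1 with rfl | hcX
        · exact absurd huA hc.2
        · exact ⟨c, Finset.mem_sdiff.2 ⟨hcX, fun h => hc.2 (Finset.mem_inter.1 h).1⟩⟩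
      obtain ⟨a, ha, b, hb, hab⟩ := hX (A ∩ X) hsub hAX hc
      rw [Finset.mem_sdiff] at hb
      refine ⟨a, (Finset.mem_inter.1 ha).1, b, Finset.mem_sdiff.2 ⟨Finset.mem_insert_of_mem hb.1, fun h => hb.2 ?_⟩, hab⟩
      exact Finset.mem_inter.2 ⟨h, hb.1⟩
    · -- `A = {u}`: the edge `u x`
      have hxA : x ∉ A := fun h => hAX ⟨x, Finset.mem_inter.2 ⟨h, hx⟩⟩
      exact ⟨u, huA, x, Finset.mem_sdiff.2 ⟨Finset.mem_insert_of_mem hx, hxA⟩, hxu.symm⟩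
  · -- `A ⊆ X`
    have hAX : A ⊆ X := by
      intro c hc
      rcases Finset.mem_insert.1 (hA hc) with rfl | hcX
      · exact absurd hc huA
      · exact hcX
    by_cases hc : (X \ A).Nonempty
    · obtain ⟨a, ha, b, hb, hab⟩ := hX A hAX hAne hc
      rw [Finset.mem_sdiff] at hb
      exact ⟨a, ha, b, Finset.mem_sdiff.2 ⟨Finset.mem_insert_of_mem hb.1, hb.2⟩, hab⟩
    · -- `A = X`: the edge `x u`
      have hXA : X ⊆ A := by
        intro c hcX
        by_contra hcA
        exact hc ⟨c, Finset.mem_sdiff.2 ⟨hcX, hcA⟩⟩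
      exact ⟨x, hXA hx, u, Finset.mem_sdiff.2 ⟨Finset.mem_insert_self _ _, huA⟩, hxu⟩

/-- **Closure step** of the proof of eq. (probiid): if `E` has a connected `α`-subset of size `≥ t` (`α ≤ 1`), then it
has one whose boundary contains no vertex of `E` ("we can construct `X'` by repeatedly adding vertices in `∂X ∩ E`
until we cannot do so … `|X' ∩ E| - |X ∩ E| = |X'| - |X|` … implies `|X' ∩ E| ≥ α|X'|`"; here: a connected `α`-subset of
maximal cardinality). [cite: FawziGrospellierLeverrier2018, §7.2 proof of eq. (probiid) (arXiv v2 p0020 L5-14)] -/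
theorem exists_alphaCluster_boundary_disjoint {α : ℝ} (hα1 : α ≤ 1) {t : ℕ} {E : Finset V}
    (h : HasAlphaCluster G α t E) :
    ∃ X : Finset V, IsGraphConnected G X ∧ t ≤ X.card ∧ IsAlphaSubset α E X ∧
      Disjoint ((X.biUnion fun x => G.neighborFinset x) \ X) E := by
  classical
  set good : Finset (Finset V) :=
    univ.filter fun X => IsGraphConnected G X ∧ t ≤ X.card ∧ IsAlphaSubset α E X with hgood
  have hne : good.Nonempty := by
    obtain ⟨X, hX⟩ := h
    exact ⟨X, by rw [hgood, Finset.mem_filter]; exact ⟨Finset.mem_univ _, hX⟩⟩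
  obtain ⟨X, hXg, hmax⟩ := Finset.exists_max_image good (fun X => X.card) hne
  rw [hgood, Finset.mem_filter] at hXg
  obtain ⟨-, hconn, htX, hαX⟩ := hXg
  refine ⟨X, hconn, htX, hαX, ?_⟩
  rw [Finset.disjoint_left]
  intro u hu huE
  rw [mem_vertexBoundary_iff] at hu
  obtain ⟨huX, x, hx, hxu⟩ := hu
  -- `insert u X` is a larger good set
  have hgood' : insert u X ∈ good := by
    rw [hgood, Finset.mem_filter]
    refine ⟨Finset.mem_univ _, isGraphConnected_insert_of_adj hconn hx hxu, ?_, ?_⟩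
    · rw [Finset.card_insert_of_notMem huX]; omega
    · -- `α(|X|+1) ≤ |X ∩ E| + 1`
      unfold IsAlphaSubset at hαX ⊢
      rw [Finset.card_insert_of_notMem huX, Finset.insert_inter_of_mem huE,
        Finset.card_insert_of_notMem (fun h => huX (Finset.mem_inter.1 h).1)]
      push_cast
      nlinarith
  have := hmax _ hgood'
  rw [Finset.card_insert_of_notMem huX] at this
  omega

end Boundary

/-! ### Cylinder events under the Bernoulli (independent) weight -/

section Cylinder

variable {V : Type*} [Fintype V] [DecidableEq V]

/-- **Cylinder weights.** For `T ⊆ S` the event "the configuration on `S` is exactly `T`" (`E ∩ S = T`) has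
Bernoulli weight `p^|T| (1-p)^(|S|-|T|)`: the sites of `S` are independent and the sites outside `S` are free
(substitute `E = T ∪ F`, `F ⊆ Sᶜ`, binomial theorem on `Sᶜ`). Generalises `sum_bernoulliWeight_filter_superset` (`S = T`).
[cite: FawziGrospellierLeverrier2018, Def 7 (independent noise; used in §7.2 as "Σ_{m ≥ αs} C(s,m) p^m (1-p)^{s-m+|∂X|}")] -/
theorem sum_bernoulliWeight_filter_inter_eq (p : ℝ) {S T : Finset V} (hTS : T ⊆ S) :
    ∑ E ∈ univ.filter (fun E => E ∩ S = T), bernoulliWeight p E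
      = p ^ T.card * (1 - p) ^ (S.card - T.card) := by
  classical
  have hbij : ∑ E ∈ univ.filter (fun E => E ∩ S = T), bernoulliWeight p E =
      ∑ F ∈ (Sᶜ).powerset, bernoulliWeight p (T ∪ F) := by
    refine Finset.sum_nbij' (fun E => E \ S) (fun F => T ∪ F) ?_ ?_ ?_ ?_ ?_
    · intro E _
      rw [Finset.mem_powerset]
      intro x hx
      rw [Finset.mem_sdiff] at hx
      exact Finset.mem_compl.2 hx.2
    · intro F hF
      rw [Finset.mem_powerset] at hF
      rw [Finset.mem_filter]
      refine ⟨Finset.mem_univ _, ?_⟩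
      rw [Finset.union_inter_distrib_right, Finset.inter_eq_left.2 hTS]
      have hFS : F ∩ S = ∅ := by
        rw [← Finset.disjoint_iff_inter_eq_empty]
        exact Finset.disjoint_left.2 fun x hxF hxS => (Finset.mem_compl.1 (hF hxF)) hxS
      rw [hFS, Finset.union_empty]
    · intro E hE
      rw [Finset.mem_filter] at hE
      rw [← hE.2, Finset.union_comm]
      exact Finset.sdiff_union_inter E S
    · intro F hF
      rw [Finset.mem_powerset] at hF
      rw [Finset.union_sdiff_distrib, Finset.sdiff_eq_empty_iff_subset.2 hTS, Finset.empty_union]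
      refine Finset.sdiff_eq_self_of_disjoint ?_
      exact Finset.disjoint_left.2 fun x hxF hxS => (Finset.mem_compl.1 (hF hxF)) hxS
    · intro E hE
      rw [Finset.mem_filter] at hE
      congr 1
      rw [← hE.2, Finset.union_comm]
      exact (Finset.sdiff_union_inter E S).symm
  rw [hbij]
  have hdisj : ∀ F ∈ (Sᶜ).powerset, Disjoint T F := by
    intro F hF
    rw [Finset.mem_powerset] at hF
    exact Finset.disjoint_left.2 fun x hxT hxF => (Finset.mem_compl.1 (hF hxF)) (hTS hxT)
  have hrew : ∀ F ∈ (Sᶜ).powerset, bernoulliWeight p (T ∪ F) =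
      p ^ T.card * (1 - p) ^ (S.card - T.card) * (p ^ F.card * (1 - p) ^ ((Sᶜ).card - F.card)) := by
    intro F hF
    have hFc : F.card ≤ (Sᶜ).card := Finset.card_le_card (Finset.mem_powerset.1 hF)
    have hSc : (Sᶜ).card = Fintype.card V - S.card := Finset.card_compl S
    have hSle : S.card ≤ Fintype.card V := Finset.card_le_univ S
    have hTle : T.card ≤ S.card := Finset.card_le_card hTS
    unfold bernoulliWeight
    rw [Finset.card_union_of_disjoint (hdisj F hF), pow_add]
    have : Fintype.card V - (T.card + F.card) = (S.card - T.card) + ((Sᶜ).card - F.card) := by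
      rw [hSc]; omega
    rw [this, pow_add]
    ring
  rw [Finset.sum_congr rfl hrew, ← Finset.mul_sum, Finset.sum_pow_mul_eq_add_pow,
    show p + (1 - p) = 1 by ring, one_pow, mul_one]

/-- The event "`X ⊆ E` and `E` avoids `B`", for disjoint `X`, `B`, has Bernoulli weight `p^|X| (1-p)^|B|`
(with `B = ∂X`: "`p^s (1-p)^{|∂X|}`", the weight of "`X` is the connected component of `E`").
[cite: FawziGrospellierLeverrier2018, §7.2 eq. (alpha=1) (arXiv v2 p0020 L22-26)] -/
theorem sum_bernoulliWeight_filter_subset_disjoint (p : ℝ) {X B : Finset V} (hXB : Disjoint X B) :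
    ∑ E ∈ univ.filter (fun E => X ⊆ E ∧ Disjoint B E), bernoulliWeight p E
      = p ^ X.card * (1 - p) ^ B.card := by
  classical
  have hfilter : univ.filter (fun E : Finset V => X ⊆ E ∧ Disjoint B E)
      = univ.filter (fun E => E ∩ (X ∪ B) = X) := by
    refine Finset.filter_congr fun E _ => ?_
    constructor
    · rintro ⟨hXE, hBE⟩
      rw [Finset.inter_union_distrib_left, Finset.inter_eq_right.2 hXE,
        Finset.disjoint_iff_inter_eq_empty.1 hBE.symm, Finset.union_empty]
    · intro hE
      constructor
      · intro x hx
        have : x ∈ E ∩ (X ∪ B) := hE.symm ▸ hx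
        exact (Finset.mem_inter.1 this).1
      · exact Finset.disjoint_left.2 fun x hxB hxE =>
          (Finset.disjoint_left.1 hXB) (by
            have : x ∈ E ∩ (X ∪ B) := Finset.mem_inter.2 ⟨hxE, Finset.mem_union_right _ hxB⟩
            rw [hE] at this
            exact this) hxB
  rw [hfilter, sum_bernoulliWeight_filter_inter_eq p Finset.subset_union_left,
    Finset.card_union_of_disjoint hXB, Nat.add_sub_cancel_left]

open Classical in
/-- **The exact weight of "`X` is an `α`-subset of `E` and `E` avoids `B`"** (disjoint `X`, `B`; `B = ∂X` in
§7.2): `Σ_{E : α|X| ≤ |X ∩ E|, B ∩ E = ∅} p^|E|(1-p)^(|V|-|E|) = (1-p)^|B| Σ_{m ≥ α|X|} C(|X|,m) p^m (1-p)^(|X|-m)`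
(partition by `T = E ∩ X`; each fibre is the cylinder `E ∩ (X ∪ B) = T`).
[cite: FawziGrospellierLeverrier2018, §7.2 proof of eq. (probiid) ("P[A(E,α,s,v) ≠ ∅] ≤ Σ_X Σ_{m ≥ αs} C(s,m) p^m (1-p)^{s-m+|∂X|}"; arXiv v2 p0020 L16-20)] -/
theorem sum_bernoulliWeight_alphaSubset_disjoint (p α : ℝ) {X B : Finset V} (hXB : Disjoint X B) :
    ∑ E ∈ univ.filter (fun E => IsAlphaSubset α E X ∧ Disjoint B E), bernoulliWeight p E
      = (1 - p) ^ B.card * ∑ m ∈ (range (X.card + 1)).filter (fun m : ℕ => α * (X.card : ℝ) ≤ (m : ℝ)),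
          (X.card.choose m : ℝ) * p ^ m * (1 - p) ^ (X.card - m) := by
  classical
  set F : Finset (Finset V) := univ.filter (fun E => IsAlphaSubset α E X ∧ Disjoint B E) with hF
  -- partition by the trace on `X`
  have hfib := Finset.sum_fiberwise_of_maps_to (s := F) (t := X.powerset) (g := fun E => E ∩ X)
    (fun E _ => Finset.mem_powerset.2 Finset.inter_subset_right) (bernoulliWeight p)
  rw [← hfib]
  -- each fibre is a cylinder on `X ∪ B`, or empty
  have hfibre : ∀ T ∈ X.powerset,
      ∑ E ∈ F with E ∩ X = T, bernoulliWeight p E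
        = if α * X.card ≤ T.card then p ^ T.card * (1 - p) ^ (X.card - T.card) * (1 - p) ^ B.card else 0 := by
    intro T hT
    rw [Finset.mem_powerset] at hT
    have hTB : Disjoint T B := Finset.disjoint_of_subset_left hT hXB
    have hset : F.filter (fun E => E ∩ X = T)
        = if α * X.card ≤ T.card then univ.filter (fun E => E ∩ (X ∪ B) = T) else ∅ := by
      split_ifs with hαT
      · ext E
        rw [hF, Finset.filter_filter, Finset.mem_filter, Finset.mem_filter]
        simp only [Finset.mem_univ, true_and]
        constructor
        · rintro ⟨⟨-, hBE⟩, hEX⟩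
          rw [Finset.inter_union_distrib_left, hEX, Finset.disjoint_iff_inter_eq_empty.1 hBE.symm,
            Finset.union_empty]
        · intro hE
          have hEX : E ∩ X = T := by
            have h1 : E ∩ (X ∪ B) ∩ X = T ∩ X := by rw [hE]
            rwa [Finset.inter_assoc, Finset.union_inter_cancel_left, Finset.inter_eq_left.2 hT] at h1
          refine ⟨⟨?_, ?_⟩, hEX⟩
          · unfold IsAlphaSubset
            rw [Finset.inter_comm, hEX]; exact hαT
          · refine Finset.disjoint_left.2 fun x hxB hxE => ?_
            have hx : x ∈ E ∩ (X ∪ B) := Finset.mem_inter.2 ⟨hxE, Finset.mem_union_right _ hxB⟩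
            rw [hE] at hx
            exact (Finset.disjoint_left.1 hTB) hx hxB
      · ext E
        rw [hF, Finset.filter_filter, Finset.mem_filter]
        simp only [Finset.mem_univ, true_and, Finset.notMem_empty, iff_false, not_and]
        rintro ⟨hαE, -⟩ hEX
        apply hαT
        unfold IsAlphaSubset at hαE
        rwa [Finset.inter_comm, hEX] at hαE
    rw [hset]
    split_ifs with hαT
    · rw [sum_bernoulliWeight_filter_inter_eq p (hT.trans Finset.subset_union_left),
        Finset.card_union_of_disjoint hXB]
      have hTle : T.card ≤ X.card := Finset.card_le_card hT
      rw [show X.card + B.card - T.card = (X.card - T.card) + B.card by omega, pow_add]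
      ring
    · simp
  rw [Finset.sum_congr rfl hfibre]
  -- regroup by `|T| = m`
  rw [Finset.sum_powerset_apply_card
    (fun m => if α * X.card ≤ (m : ℝ) then p ^ m * (1 - p) ^ (X.card - m) * (1 - p) ^ B.card else 0)]
  rw [Finset.sum_filter, Finset.mul_sum]
  refine Finset.sum_congr rfl fun m _ => ?_
  rw [nsmul_eq_mul]
  split_ifs <;> ring

/-- **Eq. (alpha=1)**: for `0 ≤ p ≤ 1` and a vertex `v`,
`Σ_{X connected, v ∈ X} p^|X| (1-p)^|∂X| ≤ 1` — the summand is the probability that `X` is EXACTLY the connected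
component of `v` in the independent error `E` (`X ⊆ E`, `∂X ∩ E = ∅`), and these events are pairwise disjoint
("`P[A(E,1,s,v) ≠ ∅] = Σ_{X ∈ 𝒞_s(v)} p^s (1-p)^{|∂X|} ≤ 1`", here summed over all sizes `s` at once).
[cite: FawziGrospellierLeverrier2018, §7.2 eq. (alpha=1) (arXiv v2 p0020 L22-26)] -/
theorem sum_connected_pow_mul_pow_boundary_le_one {G : SimpleGraph V} [DecidableRel G.Adj]
    {p : ℝ} (hp0 : 0 ≤ p) (hp1 : p ≤ 1) (v : V) :
    ∑ X ∈ univ.filter (fun X => IsGraphConnected G X ∧ v ∈ X),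
        p ^ X.card * (1 - p) ^ ((X.biUnion fun x => G.neighborFinset x) \ X).card ≤ 1 := by
  classical
  set conn : Finset (Finset V) := univ.filter (fun X => IsGraphConnected G X ∧ v ∈ X) with hconn
  set cyl : Finset V → Finset (Finset V) := fun X =>
    univ.filter fun E => X ⊆ E ∧ Disjoint ((X.biUnion fun x => G.neighborFinset x) \ X) E with hcyl
  have hterm : ∀ X ∈ conn, p ^ X.card * (1 - p) ^ ((X.biUnion fun x => G.neighborFinset x) \ X).card
      = ∑ E ∈ cyl X, bernoulliWeight p E := by
    intro X _
    rw [hcyl]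
    exact (sum_bernoulliWeight_filter_subset_disjoint p Finset.disjoint_sdiff).symm
  rw [Finset.sum_congr rfl hterm]
  -- a connected `X ∋ v` with `X ⊆ E` that sees no error on its boundary is the component of `v`: uniqueness
  have hsubset : ∀ {X X' E : Finset V}, IsGraphConnected G X → v ∈ X → v ∈ X' → X ⊆ E →
      Disjoint ((X'.biUnion fun x => G.neighborFinset x) \ X') E → X ⊆ X' := by
    intro X X' E hX hvX hvX' hXE hB'
    by_contra hnot
    obtain ⟨x, hxX, hxX'⟩ := Finset.not_subset.1 hnot
    obtain ⟨a, ha, b, hb, hab⟩ := hX (X ∩ X') Finset.inter_subset_left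
      ⟨v, Finset.mem_inter.2 ⟨hvX, hvX'⟩⟩
      ⟨x, Finset.mem_sdiff.2 ⟨hxX, fun h => hxX' (Finset.mem_inter.1 h).2⟩⟩
    rw [Finset.mem_sdiff] at hb
    have hbX' : b ∉ X' := fun h => hb.2 (Finset.mem_inter.2 ⟨hb.1, h⟩)
    have hb_bd : b ∈ (X'.biUnion fun x => G.neighborFinset x) \ X' :=
      mem_vertexBoundary_iff.2 ⟨hbX', a, (Finset.mem_inter.1 ha).2, hab⟩
    exact (Finset.disjoint_left.1 hB') hb_bd (hXE hb.1)
  have hdisj : (conn : Set (Finset V)).PairwiseDisjoint cyl := by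
    intro X hX X' hX' hne
    rw [Finset.mem_coe, hconn, Finset.mem_filter] at hX hX'
    rw [Function.onFun, Finset.disjoint_left]
    intro E hE hE'
    rw [hcyl, Finset.mem_filter] at hE hE'
    exact hne (Finset.Subset.antisymm (hsubset hX.2.1 hX.2.2 hX'.2.2 hE.2.1 hE'.2.2)
      (hsubset hX'.2.1 hX'.2.2 hX.2.2 hE'.2.1 hE.2.2))
  rw [← Finset.sum_biUnion hdisj]
  calc ∑ E ∈ conn.biUnion cyl, bernoulliWeight p E
      ≤ ∑ E, bernoulliWeight p E :=
        Finset.sum_le_sum_of_subset_of_nonneg (Finset.subset_univ _)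
          fun E _ _ => bernoulliWeight_nonneg hp0 hp1 E
    _ = 1 := sum_bernoulliWeight p

end Cylinder

/-! ### Lemma 26: the Chernoff bound for the binomial tail -/

section Chernoff

/-- **FGL18 Lemma 26 (Chernoff bound for the binomial distribution)**, in closed product form: for
`0 < p ≤ α ≤ 1` and `s ∈ ℕ`, `Σ_{m ≥ αs} C(s,m) p^m (1-p)^{s-m} ≤ 2^{-s D(α‖p)}` with
`2^{-D(α‖p)} = (p/α)^α ((1-p)/(1-α))^{1-α}` (exponential tilting: `C(s,m)p^m(1-p)^{s-m} =
C(s,m)α^m(1-α)^{s-m} · (p/α)^m ((1-p)/(1-α))^{s-m}`, the last factor is `≤ (p/α)^{αs}((1-p)/(1-α))^{(1-α)s}`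
for `m ≥ αs` since `p/α ≤ 1 ≤ (1-p)/(1-α)`, and `Σ_m C(s,m)α^m(1-α)^{s-m} = 1`). The printed lemma takes any
`k ≥ sp` in place of `αs`; this is the case used in §7.2.
[cite: FawziGrospellierLeverrier2018, Lemma 26 (§7.2, arXiv v2 p0019 L31-36)] -/
theorem binomial_tail_le_chernoff {p α : ℝ} (hp0 : 0 < p) (hpα : p ≤ α) (hα1 : α ≤ 1) (s : ℕ) :
    ∑ m ∈ (range (s + 1)).filter (fun m : ℕ => α * (s : ℝ) ≤ (m : ℝ)), (s.choose m : ℝ) * p ^ m * (1 - p) ^ (s - m)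
      ≤ ((p / α) ^ α * ((1 - p) / (1 - α)) ^ (1 - α)) ^ s := by
  have hα0 : 0 < α := hp0.trans_le hpα
  rcases eq_or_lt_of_le hα1 with rfl | hα1'
  · -- `α = 1`: only `m = s` survives
    have hfilter : (range (s + 1)).filter (fun m : ℕ => (1 : ℝ) * (s : ℝ) ≤ (m : ℝ)) = {s} := by
      ext m
      simp only [Finset.mem_filter, Finset.mem_range, Finset.mem_singleton, one_mul, Nat.cast_le]
      omega
    rw [hfilter, Finset.sum_singleton, Nat.choose_self, Nat.sub_self]
    simp
  -- `α < 1`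
  have hp1 : p < 1 := lt_of_le_of_lt hpα hα1'
  have h1α : 0 < 1 - α := by linarith
  have hbase1 : p / α ≤ 1 := (div_le_one hα0).2 hpα
  have hbase1' : 0 < p / α := div_pos hp0 hα0
  have hbase2 : 1 ≤ (1 - p) / (1 - α) := by rw [one_le_div h1α]; linarith
  set M : ℝ := ((p / α) ^ α * ((1 - p) / (1 - α)) ^ (1 - α)) ^ s with hM
  have hM' : M = (p / α) ^ (α * s) * ((1 - p) / (1 - α)) ^ ((1 - α) * s) := by
    rw [hM, mul_pow, ← Real.rpow_natCast ((p / α) ^ α), ← Real.rpow_natCast (((1 - p) / (1 - α)) ^ (1 - α)),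
      ← Real.rpow_mul hbase1'.le, ← Real.rpow_mul (by linarith : (0 : ℝ) ≤ (1 - p) / (1 - α))]
  have hM0 : 0 ≤ M := by rw [hM]; positivity
  -- termwise tilting bound
  have hterm : ∀ m ∈ (range (s + 1)).filter (fun m : ℕ => α * (s : ℝ) ≤ (m : ℝ)),
      (s.choose m : ℝ) * p ^ m * (1 - p) ^ (s - m)
        ≤ M * ((s.choose m : ℝ) * α ^ m * (1 - α) ^ (s - m)) := by
    intro m hm
    rw [Finset.mem_filter, Finset.mem_range] at hm
    have hms : m ≤ s := Nat.lt_succ_iff.1 hm.1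
    have hαm : α * s ≤ m := hm.2
    have hsplit : (p : ℝ) ^ m * (1 - p) ^ (s - m)
        = ((p / α) ^ m * ((1 - p) / (1 - α)) ^ (s - m)) * (α ^ m * (1 - α) ^ (s - m)) := by
      rw [div_pow, div_pow]
      field_simp
    have hle1 : (p / α) ^ m ≤ (p / α) ^ (α * s) := by
      rw [← Real.rpow_natCast]
      exact Real.rpow_le_rpow_of_exponent_ge hbase1' hbase1 hαm
    have hle2 : ((1 - p) / (1 - α)) ^ (s - m) ≤ ((1 - p) / (1 - α)) ^ ((1 - α) * s) := by
      rw [← Real.rpow_natCast]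
      refine Real.rpow_le_rpow_of_exponent_le hbase2 ?_
      rw [Nat.cast_sub hms]
      linarith
    have hprod : (p / α) ^ m * ((1 - p) / (1 - α)) ^ (s - m) ≤ M := by
      rw [hM']
      exact mul_le_mul hle1 hle2 (pow_nonneg (by linarith) _) (Real.rpow_nonneg hbase1'.le _)
    have hC : (0 : ℝ) ≤ (s.choose m : ℝ) * (α ^ m * (1 - α) ^ (s - m)) := by positivity
    calc (s.choose m : ℝ) * p ^ m * (1 - p) ^ (s - m)
        = ((p / α) ^ m * ((1 - p) / (1 - α)) ^ (s - m)) * ((s.choose m : ℝ) * (α ^ m * (1 - α) ^ (s - m))) := by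
          rw [mul_assoc, hsplit]; ring
      _ ≤ M * ((s.choose m : ℝ) * (α ^ m * (1 - α) ^ (s - m))) := mul_le_mul_of_nonneg_right hprod hC
      _ = M * ((s.choose m : ℝ) * α ^ m * (1 - α) ^ (s - m)) := by ring
  refine (Finset.sum_le_sum hterm).trans ?_
  rw [← Finset.mul_sum]
  have hfull : ∑ m ∈ (range (s + 1)).filter (fun m : ℕ => α * (s : ℝ) ≤ (m : ℝ)), (s.choose m : ℝ) * α ^ m * (1 - α) ^ (s - m)
      ≤ ∑ m ∈ range (s + 1), (s.choose m : ℝ) * α ^ m * (1 - α) ^ (s - m) :=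
    Finset.sum_le_sum_of_subset_of_nonneg (Finset.filter_subset _ _) fun m _ _ => by positivity
  have hone : ∑ m ∈ range (s + 1), (s.choose m : ℝ) * α ^ m * (1 - α) ^ (s - m) = 1 := by
    calc ∑ m ∈ range (s + 1), (s.choose m : ℝ) * α ^ m * (1 - α) ^ (s - m)
        = ∑ m ∈ range (s + 1), α ^ m * (1 - α) ^ (s - m) * (s.choose m : ℝ) :=
          Finset.sum_congr rfl fun m _ => by ring
      _ = (α + (1 - α)) ^ s := (add_pow α (1 - α) s).symm
      _ = 1 := by rw [show α + (1 - α) = 1 by ring, one_pow]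
  calc M * ∑ m ∈ (range (s + 1)).filter (fun m : ℕ => α * (s : ℝ) ≤ (m : ℝ)), (s.choose m : ℝ) * α ^ m * (1 - α) ^ (s - m)
      ≤ M * ∑ m ∈ range (s + 1), (s.choose m : ℝ) * α ^ m * (1 - α) ^ (s - m) :=
        mul_le_mul_of_nonneg_left hfull hM0
    _ = M := by rw [hone, mul_one]

/-- `2^{h(α)}` in the tree's (natural-log) vocabulary: `e^{binEntropy α} = α^{-α} (1-α)^{-(1-α)}` for `0 < α ≤ 1`
(at `α = 1` both sides are `1`, with Lean's `0⁻¹ = 0`, `0^0 = 1`).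
[cite: FawziGrospellierLeverrier2018, Lemma 25 ("h(x) = -x log₂ x - (1-x) log₂(1-x) is the binary entropy function"; §7.2, arXiv v2 p0019)] -/
theorem exp_binEntropy_eq_inv_rpow {α : ℝ} (hα0 : 0 < α) (hα1 : α ≤ 1) :
    Real.exp (Real.binEntropy α) = (α⁻¹) ^ α * ((1 - α)⁻¹) ^ (1 - α) := by
  rcases eq_or_lt_of_le hα1 with rfl | hα1'
  · simp
  have h1α : 0 < 1 - α := by linarith
  rw [Real.binEntropy, Real.exp_add, Real.rpow_def_of_pos (inv_pos.2 hα0),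
    Real.rpow_def_of_pos (inv_pos.2 h1α), mul_comm (Real.log α⁻¹), mul_comm (Real.log (1 - α)⁻¹)]

/-- `2^{-D(α‖p)}` in the tree's (natural-log) vocabulary: `(p/α)^α ((1-p)/(1-α))^{1-α} = p^α (1-p)^{1-α} e^{h(α)}`
with `e^{h(α)} = α^{-α}(1-α)^{-(1-α)}` (`0 < p < 1`, `0 < α ≤ 1`; at `α = 1` both sides are `p`).
[cite: FawziGrospellierLeverrier2018, §7.2 proof of eq. (probiid) ("q = (1-p)^{d-1-α} p^α 2^{h(α)+(d-1)h(1/(d-1))}"; arXiv v2 p0020 L35)] -/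
theorem chernoff_base_eq {p α : ℝ} (hp0 : 0 < p) (hp1 : p < 1) (hα0 : 0 < α) (hα1 : α ≤ 1) :
    (p / α) ^ α * ((1 - p) / (1 - α)) ^ (1 - α)
      = p ^ α * (1 - p) ^ (1 - α) * Real.exp (Real.binEntropy α) := by
  rcases eq_or_lt_of_le hα1 with rfl | hα1'
  · simp [Real.rpow_one]
  have h1α : 0 < 1 - α := by linarith
  have h1p : 0 < 1 - p := by linarith
  rw [exp_binEntropy_eq_inv_rpow hα0 hα1, Real.div_rpow hp0.le hα0.le, Real.div_rpow h1p.le h1α.le,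
    Real.inv_rpow hα0.le, Real.inv_rpow h1α.le]
  field_simp

end Chernoff

/-! ### Theorem 17, eq. (probiid): the independent error model -/

section IID

variable {V : Type*} [Fintype V] [DecidableEq V]

/-- Sums over a union of events are at most the sum of the sums (nonnegative weights). [folklore] -/
private theorem sum_biUnion_le_sum₃ {ι β : Type*} [DecidableEq β] (T : Finset ι) (B : ι → Finset β)
    (W : β → ℝ) (hW : ∀ b, 0 ≤ W b) : ∑ b ∈ T.biUnion B, W b ≤ ∑ a ∈ T, ∑ b ∈ B a, W b := by
  classical
  induction T using Finset.induction_on with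
  | empty => simp
  | insert a T ha ih =>
    rw [Finset.biUnion_insert, Finset.sum_insert ha]
    have hu : ∑ b ∈ B a ∪ T.biUnion B, W b ≤ ∑ b ∈ B a, W b + ∑ b ∈ T.biUnion B, W b := by
      rw [← Finset.sum_union_inter]
      have : 0 ≤ ∑ b ∈ B a ∩ T.biUnion B, W b := sum_nonneg fun b _ => hW b
      linarith
    linarith

/-- **The `p = 1/(d-1)` trick, summed over the connected sets of a given size**: for `0 ≤ p' ≤ 1` and `s ≥ 1`,
`Σ_{X ∈ 𝒞_s(𝒢)} p'^|X| (1-p')^|∂X| ≤ Σ_v Σ_{X ∈ 𝒞_s(v)} p'^|X|(1-p')^|∂X| ≤ |V|` (each `X` contains a vertex; eq. (alpha=1)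
per vertex). [cite: FawziGrospellierLeverrier2018, §7.2 proof of eq. (probiid) ("Σ_{X ∈ 𝒞_s(v)} (1/(d-1))^s (1-1/(d-1))^{|∂X|} ≤ 1 … from Eq. (alpha=1)", summed over v ∈ V; arXiv v2 p0020 L30-38)] -/
theorem sum_connectedOfCard_pow_mul_pow_boundary_le_card {G : SimpleGraph V} [DecidableRel G.Adj]
    {p' : ℝ} (hp0 : 0 ≤ p') (hp1 : p' ≤ 1) {s : ℕ} (hs : 1 ≤ s) :
    ∑ X ∈ connectedOfCard G s, p' ^ X.card * (1 - p') ^ ((X.biUnion fun x => G.neighborFinset x) \ X).card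
      ≤ Fintype.card V := by
  classical
  set f : Finset V → ℝ := fun X =>
    p' ^ X.card * (1 - p') ^ ((X.biUnion fun x => G.neighborFinset x) \ X).card with hf
  have hf0 : ∀ X, 0 ≤ f X := fun X => by rw [hf]; exact mul_nonneg (pow_nonneg hp0 _) (pow_nonneg (by linarith) _)
  have hmem : ∀ {S : Finset V}, S ∈ connectedOfCard G s ↔ S.card = s ∧ IsGraphConnected G S := by
    intro S; simp [connectedOfCard]
  -- `f X ≤ |X| · f X = Σ_{v ∈ X} f X`
  have h1 : ∑ X ∈ connectedOfCard G s, f X ≤ ∑ X ∈ connectedOfCard G s, ∑ v ∈ X, f X := by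
    refine Finset.sum_le_sum fun X hX => ?_
    rw [Finset.sum_const, nsmul_eq_mul, (hmem.1 hX).1]
    have : (1 : ℝ) ≤ s := by exact_mod_cast hs
    nlinarith [hf0 X]
  -- exchange the sums
  have h2 : ∑ X ∈ connectedOfCard G s, ∑ v ∈ X, f X
      = ∑ v ∈ (univ : Finset V), ∑ X ∈ (connectedOfCard G s).filter (fun X => v ∈ X), f X := by
    refine Finset.sum_comm' ?_
    intro X v
    simp only [Finset.mem_filter, Finset.mem_univ, and_true]
  -- per vertex: eq. (alpha=1)
  have h3 : ∀ v : V, ∑ X ∈ (connectedOfCard G s).filter (fun X => v ∈ X), f X ≤ 1 := by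
    intro v
    have hsub : (connectedOfCard G s).filter (fun X => v ∈ X)
        ⊆ univ.filter (fun X => IsGraphConnected G X ∧ v ∈ X) := by
      intro X hX
      rw [Finset.mem_filter] at hX ⊢
      exact ⟨Finset.mem_univ _, (hmem.1 hX.1).2, hX.2⟩
    refine (Finset.sum_le_sum_of_subset_of_nonneg hsub fun X _ _ => hf0 X).trans ?_
    rw [hf]
    exact sum_connected_pow_mul_pow_boundary_le_one hp0 hp1 v
  calc ∑ X ∈ connectedOfCard G s, f X
      ≤ ∑ X ∈ connectedOfCard G s, ∑ v ∈ X, f X := h1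
    _ = ∑ v ∈ (univ : Finset V), ∑ X ∈ (connectedOfCard G s).filter (fun X => v ∈ X), f X := h2
    _ ≤ ∑ v ∈ (univ : Finset V), (1 : ℝ) := Finset.sum_le_sum fun v _ => h3 v
    _ = Fintype.card V := by simp

open Classical in
/-- **Fawzi–Grospellier–Leverrier 2018, Theorem 17, second clause — eq. (probiid), the INDEPENDENT error model,
PROVED**: for a graph `𝒢 = (V, ℰ)` of degree `≤ d` (`d ≥ 3`), `α ∈ (0,1]`, an integer `t ≥ 1`, and vertices occupied
independently with probability `p < α/(d-1)` (the tree's `bernoulliWeight p`, "the special case, where vertices are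
chosen independently with probability `p < α/(d-1)`"):
`P[MaxConn_α(E) ≥ t] ≤ |V| ((d-1)/(d-2))² q^t/(1-q)`, `q = (1-p)^{d-1-α} p^α 2^{h(α)} (d-1)(1+1/(d-2))^{d-2}`
(natural-log form: `2^{h(α)} = e^{binEntropy α}`), under the side condition `q < 1` that the print leaves implicit
("if `p` is chosen small enough so that `q < 1`"; see `fgl18_lemma29` for `p < p_iid ⇒ q < 1`). Proof as printed
(App. §7.2): closure (`∂X ∩ E = ∅`), union bound over `s ≥ t`, `v ∈ V`, `X ∈ 𝒞_s(v)`, the exact cylinder weight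
`(1-p)^{|∂X|} Σ_{m ≥ αs} C(s,m)p^m(1-p)^{s-m}`, Lemma 26, `|∂X| ≤ (d-2)s+2` with `(1-p)/(1-1/(d-1)) ≥ 1`, eq. (alpha=1)
at `p = 1/(d-1)`, and the geometric sum. "The main improvement compared to the local stochastic bound is the factor
`(1-p)^{d-1-α}`." [cite: FawziGrospellierLeverrier2018, Thm 17 eq. (probiid) (§4, arXiv v2 p0013 L25-31) and its proof (§7.2, p0019 L78 – p0020 L50)] -/
theorem fgl18_theorem17_iid (G : SimpleGraph V) [DecidableRel G.Adj] {d : ℕ} (hd : 3 ≤ d)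
    (hdeg : ∀ v, G.degree v ≤ d) {α : ℝ} (hα0 : 0 < α) (hα1 : α ≤ 1) {t : ℕ} (ht : 1 ≤ t)
    {p : ℝ} (hp0 : 0 < p) (hpα : p < α / ((d : ℝ) - 1))
    (hq : (1 - p) ^ ((d : ℝ) - 1 - α) * p ^ α * Real.exp (Real.binEntropy α)
      * (((d : ℝ) - 1) * (1 + 1 / ((d : ℝ) - 2)) ^ (d - 2)) < 1) :
    ∑ E ∈ univ.filter (fun E => HasAlphaCluster G α t E), bernoulliWeight p E
      ≤ (Fintype.card V : ℝ) * (((d : ℝ) - 1) / ((d : ℝ) - 2)) ^ 2 *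
        (((1 - p) ^ ((d : ℝ) - 1 - α) * p ^ α * Real.exp (Real.binEntropy α)
            * (((d : ℝ) - 1) * (1 + 1 / ((d : ℝ) - 2)) ^ (d - 2))) ^ t
        / (1 - (1 - p) ^ ((d : ℝ) - 1 - α) * p ^ α * Real.exp (Real.binEntropy α)
            * (((d : ℝ) - 1) * (1 + 1 / ((d : ℝ) - 2)) ^ (d - 2)))) := by
  classical
  -- constants
  set K : ℝ := ((d : ℝ) - 1) * (1 + 1 / ((d : ℝ) - 2)) ^ (d - 2) with hKdef
  set q : ℝ := (1 - p) ^ ((d : ℝ) - 1 - α) * p ^ α * Real.exp (Real.binEntropy α) * K with hqdef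
  set r : ℝ := (p / α) ^ α * ((1 - p) / (1 - α)) ^ (1 - α) with hrdef
  set p' : ℝ := 1 / ((d : ℝ) - 1) with hp'def
  have hd' : (3 : ℝ) ≤ d := by exact_mod_cast hd
  have hd1 : (0 : ℝ) < (d : ℝ) - 1 := by linarith
  have hd2 : (0 : ℝ) < (d : ℝ) - 2 := by linarith
  have hcast2 : ((d - 2 : ℕ) : ℝ) = (d : ℝ) - 2 := by
    rw [Nat.cast_sub (by omega : 2 ≤ d)]; push_cast; ring
  have hαd : α / ((d : ℝ) - 1) ≤ α / 2 := div_le_div_of_nonneg_left hα0.le (by norm_num) (by linarith)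
  have hpα' : p ≤ α := by linarith
  have hp1 : p < 1 := by linarith
  have h1p : 0 < 1 - p := by linarith
  have hpp' : p ≤ p' := by
    rw [hp'def]
    have : α / ((d : ℝ) - 1) ≤ 1 / ((d : ℝ) - 1) := div_le_div_of_nonneg_right hα1 hd1.le
    linarith
  have hp'0 : 0 ≤ p' := by rw [hp'def]; positivity
  have hp'1 : p' ≤ 1 := by rw [hp'def, div_le_one hd1]; linarith
  have h1p' : 1 - p' = ((d : ℝ) - 2) / ((d : ℝ) - 1) := by rw [hp'def]; field_simp; ring
  have h1p'0 : 0 < 1 - p' := by rw [h1p']; positivity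
  have hratio : ((d : ℝ) - 1) / ((d : ℝ) - 2) = 1 + 1 / ((d : ℝ) - 2) := by field_simp; ring
  -- `r = p^α (1-p)^{1-α} e^{h}` and `q = (1-p)^{d-2} (1+1/(d-2))^{d-2} (d-1) r`
  have hr : r = p ^ α * (1 - p) ^ (1 - α) * Real.exp (Real.binEntropy α) := chernoff_base_eq hp0 hp1 hα0 hα1
  have hr0 : 0 ≤ r := by rw [hr]; positivity
  have hsplit : (1 - p) ^ ((d : ℝ) - 1 - α) = (1 - p) ^ (d - 2) * (1 - p) ^ (1 - α) := by
    rw [show (d : ℝ) - 1 - α = ((d - 2 : ℕ) : ℝ) + (1 - α) by rw [hcast2]; ring, Real.rpow_add h1p,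
      Real.rpow_natCast]
  have hqr : q = (1 - p) ^ (d - 2) * (1 + 1 / ((d : ℝ) - 2)) ^ (d - 2) * ((d : ℝ) - 1) * r := by
    rw [hqdef, hsplit, hr, hKdef]; ring
  have hq0 : 0 ≤ q := by rw [hqr]; positivity
  -- ρ = (1-p)/(1-p') ≥ 1
  set ρ : ℝ := (1 - p) / (1 - p') with hρdef
  have hρ1 : 1 ≤ ρ := by rw [hρdef, one_le_div h1p'0]; linarith
  have hρle : ρ ≤ ((d : ℝ) - 1) / ((d : ℝ) - 2) := by
    rw [hρdef, h1p', div_div_eq_mul_div]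
    refine div_le_div_of_nonneg_right ?_ hd2.le
    nlinarith
  have hρeq : ρ = (1 - p) * (1 + 1 / ((d : ℝ) - 2)) := by
    rw [hρdef, h1p', ← hratio]
    field_simp
  have hρpow : ρ ^ (d - 2) * ((d : ℝ) - 1) * r = q := by
    rw [hρeq, mul_pow, hqr]
  -- Step 1: closure + union bound over connected sets `X` with `|X| ≥ t`
  set clusters : Finset (Finset V) :=
    (Finset.Icc t (Fintype.card V)).biUnion fun s => connectedOfCard G s with hclusters
  have hmem : ∀ {s : ℕ} {S : Finset V}, S ∈ connectedOfCard G s ↔ S.card = s ∧ IsGraphConnected G S := by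
    intro s S; simp [connectedOfCard]
  set ev : Finset V → Finset (Finset V) := fun X =>
    univ.filter fun E => IsAlphaSubset α E X ∧
      Disjoint ((X.biUnion fun x => G.neighborFinset x) \ X) E with hev
  have hcover : univ.filter (fun E => HasAlphaCluster G α t E) ⊆ clusters.biUnion ev := by
    intro E hE
    rw [Finset.mem_filter] at hE
    obtain ⟨X, hXconn, htX, hXE, hXB⟩ := exists_alphaCluster_boundary_disjoint (G := G) hα1 hE.2
    rw [Finset.mem_biUnion]
    refine ⟨X, ?_, by rw [hev]; exact Finset.mem_filter.2 ⟨Finset.mem_univ _, hXE, hXB⟩⟩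
    rw [hclusters, Finset.mem_biUnion]
    exact ⟨X.card, Finset.mem_Icc.2 ⟨htX, Finset.card_le_univ X⟩, hmem.2 ⟨rfl, hXconn⟩⟩
  have hbw0 : ∀ E : Finset V, 0 ≤ bernoulliWeight p E := bernoulliWeight_nonneg hp0.le hp1.le
  have h1 : ∑ E ∈ univ.filter (fun E => HasAlphaCluster G α t E), bernoulliWeight p E
      ≤ ∑ X ∈ clusters, ∑ E ∈ ev X, bernoulliWeight p E :=
    (Finset.sum_le_sum_of_subset_of_nonneg hcover fun E _ _ => hbw0 E).trans
      (sum_biUnion_le_sum₃ clusters ev _ hbw0)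
  -- Step 2: exact cylinder weight + Chernoff, per `X`
  set g : Finset V → ℝ := fun X =>
    (1 - p) ^ ((X.biUnion fun x => G.neighborFinset x) \ X).card * r ^ X.card with hg
  have h2 : ∑ X ∈ clusters, ∑ E ∈ ev X, bernoulliWeight p E ≤ ∑ X ∈ clusters, g X := by
    refine Finset.sum_le_sum fun X _ => ?_
    rw [hev, sum_bernoulliWeight_alphaSubset_disjoint p α Finset.disjoint_sdiff, hg]
    refine mul_le_mul_of_nonneg_left ?_ (pow_nonneg h1p.le _)
    rw [hrdef]
    exact binomial_tail_le_chernoff hp0 hpα' hα1 X.card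
  have hg0 : ∀ X, 0 ≤ g X := fun X => by rw [hg]; positivity
  have h3 : ∑ X ∈ clusters, g X ≤ ∑ s ∈ Finset.Icc t (Fintype.card V), ∑ X ∈ connectedOfCard G s, g X := by
    rw [hclusters]
    exact sum_biUnion_le_sum₃ _ _ _ hg0
  -- Step 3: per size `s`: `|∂X| ≤ (d-2)s + 2`, the `(1-p)/(1-p') ≥ 1` monotonicity, eq. (alpha=1) at `p' = 1/(d-1)`
  have h4 : ∀ s ∈ Finset.Icc t (Fintype.card V),
      ∑ X ∈ connectedOfCard G s, g X
        ≤ (Fintype.card V : ℝ) * ((((d : ℝ) - 1) / ((d : ℝ) - 2)) ^ 2 * q ^ s) := by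
    intro s hs
    have hs1 : 1 ≤ s := ht.trans (Finset.mem_Icc.1 hs).1
    set N : ℕ := (d - 2) * s + 2 with hN
    -- termwise: g X ≤ ρ^N r^s (d-1)^s · p'^|X| (1-p')^|∂X|
    have hterm : ∀ X ∈ connectedOfCard G s,
        g X ≤ ρ ^ N * r ^ s * ((d : ℝ) - 1) ^ s *
          (p' ^ X.card * (1 - p') ^ ((X.biUnion fun x => G.neighborFinset x) \ X).card) := by
      intro X hX
      obtain ⟨hXs, hXconn⟩ := hmem.1 hX
      have hXne : X.Nonempty := by rw [← Finset.card_pos, hXs]; exact hs1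
      set b : ℕ := ((X.biUnion fun x => G.neighborFinset x) \ X).card with hb
      have hbN : b ≤ N := by
        have h := card_boundary_add_le hdeg hXconn hXne
        rw [← hb, hXs] at h
        have h' : (d - 2) * s = d * s - 2 * s := Nat.sub_mul d 2 s
        rw [hN]; omega
      have hmono : (1 - p) ^ b ≤ ρ ^ N * (1 - p') ^ b := by
        have heq : (1 - p) ^ b = ρ ^ b * (1 - p') ^ b := by
          rw [← mul_pow, hρdef, div_mul_cancel₀ _ h1p'0.ne']
        rw [heq]
        exact mul_le_mul_of_nonneg_right (pow_le_pow_right₀ hρ1 hbN) (pow_nonneg h1p'0.le _)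
      have hp's : p' ^ s * ((d : ℝ) - 1) ^ s = 1 := by
        rw [← mul_pow, hp'def, one_div, inv_mul_cancel₀ hd1.ne', one_pow]
      rw [hg]
      show (1 - p) ^ b * r ^ X.card ≤ ρ ^ N * r ^ s * ((d : ℝ) - 1) ^ s * (p' ^ X.card * (1 - p') ^ b)
      rw [hXs]
      calc (1 - p) ^ b * r ^ s ≤ ρ ^ N * (1 - p') ^ b * r ^ s := mul_le_mul_of_nonneg_right hmono (pow_nonneg hr0 _)
        _ = ρ ^ N * (1 - p') ^ b * r ^ s * (p' ^ s * ((d : ℝ) - 1) ^ s) := by rw [hp's, mul_one]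
        _ = ρ ^ N * r ^ s * ((d : ℝ) - 1) ^ s * (p' ^ s * (1 - p') ^ b) := by ring
    have hkey := sum_connectedOfCard_pow_mul_pow_boundary_le_card (G := G) hp'0 hp'1 hs1
    have hcoef0 : 0 ≤ ρ ^ N * r ^ s * ((d : ℝ) - 1) ^ s := by
      have : 0 ≤ ρ := le_trans zero_le_one hρ1
      positivity
    calc ∑ X ∈ connectedOfCard G s, g X
        ≤ ∑ X ∈ connectedOfCard G s, ρ ^ N * r ^ s * ((d : ℝ) - 1) ^ s *
            (p' ^ X.card * (1 - p') ^ ((X.biUnion fun x => G.neighborFinset x) \ X).card) :=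
          Finset.sum_le_sum hterm
      _ = ρ ^ N * r ^ s * ((d : ℝ) - 1) ^ s *
            ∑ X ∈ connectedOfCard G s,
              p' ^ X.card * (1 - p') ^ ((X.biUnion fun x => G.neighborFinset x) \ X).card := by
          rw [Finset.mul_sum]
      _ ≤ ρ ^ N * r ^ s * ((d : ℝ) - 1) ^ s * Fintype.card V := mul_le_mul_of_nonneg_left hkey hcoef0
      _ = (Fintype.card V : ℝ) * (ρ ^ 2 * (ρ ^ (d - 2) * ((d : ℝ) - 1) * r) ^ s) := by
          have e : (ρ ^ (d - 2) * ((d : ℝ) - 1) * r) ^ s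
              = (ρ ^ (d - 2)) ^ s * ((d : ℝ) - 1) ^ s * r ^ s := by
            rw [mul_pow, mul_pow]
          rw [e, hN, pow_add, pow_mul]; ring
      _ = (Fintype.card V : ℝ) * (ρ ^ 2 * q ^ s) := by rw [hρpow]
      _ ≤ (Fintype.card V : ℝ) * ((((d : ℝ) - 1) / ((d : ℝ) - 2)) ^ 2 * q ^ s) := by
          refine mul_le_mul_of_nonneg_left (mul_le_mul_of_nonneg_right ?_ (pow_nonneg hq0 _)) (Nat.cast_nonneg _)
          exact pow_le_pow_left₀ (le_trans zero_le_one hρ1) hρle 2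
  -- Step 4: the geometric sum
  have h5 : ∑ s ∈ Finset.Icc t (Fintype.card V), (Fintype.card V : ℝ) * ((((d : ℝ) - 1) / ((d : ℝ) - 2)) ^ 2 * q ^ s)
      ≤ (Fintype.card V : ℝ) * (((d : ℝ) - 1) / ((d : ℝ) - 2)) ^ 2 * (q ^ t / (1 - q)) := by
    rw [← Finset.mul_sum, ← Finset.mul_sum, mul_assoc]
    refine mul_le_mul_of_nonneg_left (mul_le_mul_of_nonneg_left ?_ (by positivity)) (Nat.cast_nonneg _)
    have hIcc : Finset.Icc t (Fintype.card V) = Finset.Ico t (Fintype.card V + 1) := by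
      ext s; simp only [Finset.mem_Icc, Finset.mem_Ico]; omega
    rw [hIcc]
    exact geom_sum_Ico_le_of_lt_one hq0 hq
  calc ∑ E ∈ univ.filter (fun E => HasAlphaCluster G α t E), bernoulliWeight p E
      ≤ ∑ X ∈ clusters, ∑ E ∈ ev X, bernoulliWeight p E := h1
    _ ≤ ∑ X ∈ clusters, g X := h2
    _ ≤ ∑ s ∈ Finset.Icc t (Fintype.card V), ∑ X ∈ connectedOfCard G s, g X := h3
    _ ≤ ∑ s ∈ Finset.Icc t (Fintype.card V),
          (Fintype.card V : ℝ) * ((((d : ℝ) - 1) / ((d : ℝ) - 2)) ^ 2 * q ^ s) := Finset.sum_le_sum h4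
    _ ≤ (Fintype.card V : ℝ) * (((d : ℝ) - 1) / ((d : ℝ) - 2)) ^ 2 * (q ^ t / (1 - q)) := h5

end IID

/-! ### Lemma 29: the independent threshold `p_iid` -/

section Lemma29

/-- **FGL18 Lemma 29, monotonicity**: for `d ≥ 3` and `α ∈ (0,1]`, the map
`q : p ↦ (1-p)^{d-1-α} p^α 2^{h(α)} (d-1)(1+1/(d-2))^{d-2}` is (strictly) increasing on `[0, α/(d-1)]`
("It is simple to verify that `q` is increasing": `d/dp log q = α/p - (d-1-α)/(1-p) ≥ 0 iff (d-1)p ≤ α`; here via the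
two elementary inequalities `log x ≥ 1 - 1/x`, `log x < x - 1`).
[cite: FawziGrospellierLeverrier2018, Lemma 29 (§7.2, arXiv v2 p0020 L52-56)] -/
theorem fgl18_lemma29_strictMonoOn {d : ℕ} (hd : 3 ≤ d) {α : ℝ} (hα0 : 0 < α) (hα1 : α ≤ 1) :
    StrictMonoOn (fun p : ℝ => (1 - p) ^ ((d : ℝ) - 1 - α) * p ^ α * Real.exp (Real.binEntropy α)
        * (((d : ℝ) - 1) * (1 + 1 / ((d : ℝ) - 2)) ^ (d - 2))) (Set.Icc 0 (α / ((d : ℝ) - 1))) := by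
  set K : ℝ := ((d : ℝ) - 1) * (1 + 1 / ((d : ℝ) - 2)) ^ (d - 2) with hKdef
  set m : ℝ := (d : ℝ) - 1 - α with hmdef
  have hd' : (3 : ℝ) ≤ d := by exact_mod_cast hd
  have hd1 : (0 : ℝ) < (d : ℝ) - 1 := by linarith
  have hK0 : 0 < K := by
    have h2 : (0 : ℝ) < (d : ℝ) - 2 := by linarith
    rw [hKdef]; positivity
  have hm0 : 0 < m := by rw [hmdef]; linarith
  have hc : 0 < Real.exp (Real.binEntropy α) * K := mul_pos (Real.exp_pos _) hK0
  have htop : α / ((d : ℝ) - 1) ≤ 1 / 2 := by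
    rw [div_le_iff₀ hd1]; linarith
  intro p₁ hp₁ p₂ hp₂ hlt
  simp only [Set.mem_Icc] at hp₁ hp₂
  have hp₂0 : 0 < p₂ := lt_of_le_of_lt hp₁.1 hlt
  have h1p₁ : 0 < 1 - p₁ := by linarith
  have h1p₂ : 0 < 1 - p₂ := by linarith
  show (1 - p₁) ^ m * p₁ ^ α * Real.exp (Real.binEntropy α) * K
      < (1 - p₂) ^ m * p₂ ^ α * Real.exp (Real.binEntropy α) * K
  suffices h : (1 - p₁) ^ m * p₁ ^ α < (1 - p₂) ^ m * p₂ ^ α by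
    have := mul_lt_mul_of_pos_right h hc
    linarith [this]
  rcases eq_or_lt_of_le hp₁.1 with heq | hp₁0
  · -- `p₁ = 0`
    rw [← heq, Real.zero_rpow hα0.ne', mul_zero]
    exact mul_pos (Real.rpow_pos_of_pos h1p₂ _) (Real.rpow_pos_of_pos hp₂0 _)
  -- both positive: compare the logarithms
  have e : ∀ p : ℝ, 0 < p → 0 < 1 - p →
      (1 - p) ^ m * p ^ α = Real.exp (m * Real.log (1 - p) + α * Real.log p) := by
    intro p h0 h1
    rw [Real.exp_add, Real.rpow_def_of_pos h1, Real.rpow_def_of_pos h0]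
    ring_nf
  rw [e p₁ hp₁0 h1p₁, e p₂ hp₂0 h1p₂, Real.exp_lt_exp]
  -- `log(1-p₂) - log(1-p₁) ≥ (p₁-p₂)/(1-p₂)`
  have hA : (p₁ - p₂) / (1 - p₂) ≤ Real.log (1 - p₂) - Real.log (1 - p₁) := by
    have h := Real.one_sub_inv_le_log_of_pos (x := (1 - p₂) / (1 - p₁)) (by positivity)
    rw [Real.log_div h1p₂.ne' h1p₁.ne', inv_div] at h
    have h' : 1 - (1 - p₁) / (1 - p₂) = (p₁ - p₂) / (1 - p₂) := by
      field_simp; ring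
    rw [h'] at h
    exact h
  -- `log p₂ - log p₁ > (p₂-p₁)/p₂`
  have hB : (p₂ - p₁) / p₂ < Real.log p₂ - Real.log p₁ := by
    have hne : p₁ / p₂ ≠ 1 := by
      intro heq
      rw [div_eq_one_iff_eq hp₂0.ne'] at heq
      linarith
    have h := Real.log_lt_sub_one_of_pos (x := p₁ / p₂) (by positivity) hne
    rw [Real.log_div hp₁0.ne' hp₂0.ne'] at h
    have h' : p₁ / p₂ - 1 = -((p₂ - p₁) / p₂) := by
      field_simp; ring
    rw [h'] at h
    linarith
  -- the coefficient sign: `α(1-p₂) ≥ m p₂` iff `(d-1) p₂ ≤ α`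
  have hp₂le : ((d : ℝ) - 1) * p₂ ≤ α := by
    have := hp₂.2
    rwa [le_div_iff₀ hd1, mul_comm] at this
  have hcoef : 0 ≤ m * ((p₁ - p₂) / (1 - p₂)) + α * ((p₂ - p₁) / p₂) := by
    have hrew : m * ((p₁ - p₂) / (1 - p₂)) + α * ((p₂ - p₁) / p₂)
        = (p₂ - p₁) * (α * (1 - p₂) - m * p₂) / (p₂ * (1 - p₂)) := by
      field_simp
      ring
    rw [hrew]
    refine div_nonneg (mul_nonneg (by linarith) ?_) (by positivity)
    rw [hmdef]
    nlinarith
  have h1 := mul_le_mul_of_nonneg_left hA hm0.le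
  have h2 := mul_lt_mul_of_pos_left hB hα0
  linarith

/-- **FGL18 Lemma 29, the endpoint**: `q(α/(d-1)) ≥ 1` (`d ≥ 3`, `α ∈ (0,1]`): indeed
`q(α/(d-1)) = (d-1-α)^{d-1-α} / ((d-2)^{d-2} (1-α)^{1-α}) ≥ 1` since `(x+y)^{x+y} ≥ x^x y^y` for
`x = d-2 ≥ 1`, `y = 1-α ≥ 0`. [cite: FawziGrospellierLeverrier2018, Lemma 29 (§7.2, arXiv v2 p0020 L52-66)] -/
theorem fgl18_lemma29_endpoint {d : ℕ} (hd : 3 ≤ d) {α : ℝ} (hα0 : 0 < α) (hα1 : α ≤ 1) :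
    1 ≤ (1 - α / ((d : ℝ) - 1)) ^ ((d : ℝ) - 1 - α) * (α / ((d : ℝ) - 1)) ^ α
        * Real.exp (Real.binEntropy α) * (((d : ℝ) - 1) * (1 + 1 / ((d : ℝ) - 2)) ^ (d - 2)) := by
  have hd' : (3 : ℝ) ≤ d := by exact_mod_cast hd
  set D : ℝ := (d : ℝ) - 1 with hD
  have hD0 : 0 < D := by rw [hD]; linarith
  have hD1 : 0 < D - 1 := by rw [hD]; linarith
  have hDα : 0 < D - α := by rw [hD]; linarith
  have h1α : 0 ≤ 1 - α := by linarith
  have hcast : ((d - 2 : ℕ) : ℝ) = D - 1 := by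
    rw [Nat.cast_sub (by omega : 2 ≤ d), hD]; push_cast; ring
  have hd2 : (d : ℝ) - 2 = D - 1 := by rw [hD]; ring
  rw [hd2]
  -- rewrite every factor as a quotient of powers
  have h1 : (1 - α / D) ^ (D - α) = (D - α) ^ (D - α) / D ^ (D - α) := by
    rw [show 1 - α / D = (D - α) / D by field_simp, Real.div_rpow hDα.le hD0.le]
  have h2 : (α / D) ^ α = α ^ α / D ^ α := Real.div_rpow hα0.le hD0.le α
  have h3 : Real.exp (Real.binEntropy α) = (α⁻¹) ^ α * ((1 - α)⁻¹) ^ (1 - α) :=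
    exp_binEntropy_eq_inv_rpow hα0 hα1
  have h4 : D * (1 + 1 / (D - 1)) ^ (d - 2) = D ^ (d - 1) / (D - 1) ^ (d - 2) := by
    rw [show 1 + 1 / (D - 1) = D / (D - 1) by field_simp; ring, div_pow,
      show d - 1 = (d - 2) + 1 by omega, pow_succ]
    field_simp
  rw [h1, h2, h3, h4]
  -- `D^{D-α} D^α = D^{d-1}`
  have hDpow : D ^ (D - α) * D ^ α = D ^ (d - 1) := by
    rw [← Real.rpow_add hD0, sub_add_cancel, ← Real.rpow_natCast]
    congr 1
    rw [Nat.cast_sub (by omega : 1 ≤ d), hD]; push_cast; ring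
  -- the core inequality `(D-1)^{d-2} (1-α)^{1-α} ≤ (D-α)^{D-α}`
  have hcore : (D - 1) ^ (d - 2) * (1 - α) ^ (1 - α) ≤ (D - α) ^ (D - α) := by
    have hsplit : (D - α) ^ (D - α) = (D - α) ^ (D - 1) * (D - α) ^ (1 - α) := by
      rw [← Real.rpow_add hDα]; congr 1; ring
    rw [hsplit]
    refine mul_le_mul ?_ ?_ (Real.rpow_nonneg h1α _) (Real.rpow_nonneg hDα.le _)
    · have e : (D - α) ^ (D - 1) = (D - α) ^ (d - 2) := by rw [← hcast, Real.rpow_natCast]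
      rw [e]
      exact pow_le_pow_left₀ hD1.le (by linarith) _
    · exact Real.rpow_le_rpow h1α (by linarith) h1α
  -- assemble: all factors are nonzero `rpow` atoms
  have hB0 : D ^ (D - α) ≠ 0 := (Real.rpow_pos_of_pos hD0 _).ne'
  have hE0 : D ^ α ≠ 0 := (Real.rpow_pos_of_pos hD0 _).ne'
  have hC0 : α ^ α ≠ 0 := (Real.rpow_pos_of_pos hα0 _).ne'
  have hI0 : (D - 1) ^ (d - 2) ≠ 0 := (pow_pos hD1 _).ne'
  have hG0 : (1 - α) ^ (1 - α) ≠ 0 := by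
    rw [Ne, Real.rpow_eq_zero_iff_of_nonneg h1α]
    rintro ⟨h0, hne⟩
    exact hne h0
  have hGI : 0 < (D - 1) ^ (d - 2) * (1 - α) ^ (1 - α) :=
    lt_of_le_of_ne (mul_nonneg (pow_nonneg hD1.le _) (Real.rpow_nonneg h1α _))
      (Ne.symm (mul_ne_zero hI0 hG0))
  have hval : (D - α) ^ (D - α) / D ^ (D - α) * (α ^ α / D ^ α)
        * ((α ^ α)⁻¹ * ((1 - α) ^ (1 - α))⁻¹) * (D ^ (D - α) * D ^ α / (D - 1) ^ (d - 2))
      = (D - α) ^ (D - α) / ((D - 1) ^ (d - 2) * (1 - α) ^ (1 - α)) := by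
    field_simp
  rw [Real.inv_rpow hα0.le, Real.inv_rpow h1α, ← hDpow, hval, le_div_iff₀ hGI, one_mul]
  exact hcore

/-- `p_ls^α = e^{-h(α)}/K(d)`: the defining identity of `percolationValue`. [cite: FawziGrospellierLeverrier2018, Thm 17 eq. (pls) (§4, arXiv v2 p0013)] -/
theorem percolationValue_rpow {d : ℕ} (hd : 3 ≤ d) {α : ℝ} (hα0 : 0 < α) :
    percolationValue d α ^ α
      = Real.exp (-Real.binEntropy α) / (((d : ℝ) - 1) * (1 + 1 / ((d : ℝ) - 2)) ^ (d - 2)) := by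
  have hd' : (3 : ℝ) ≤ d := by exact_mod_cast hd
  have hK0 : 0 < ((d : ℝ) - 1) * (1 + 1 / ((d : ℝ) - 2)) ^ (d - 2) := by
    have : (0 : ℝ) < (d : ℝ) - 2 := by linarith
    have : (0 : ℝ) < (d : ℝ) - 1 := by linarith
    positivity
  set K : ℝ := ((d : ℝ) - 1) * (1 + 1 / ((d : ℝ) - 2)) ^ (d - 2) with hKdef
  rw [percolationValue, ← hKdef, one_div, Real.rpow_inv_rpow (by positivity) hα0.ne']

/-- **FGL18 Lemma 29 (the independent threshold `p_iid`)**: for `d ≥ 3`, `α ∈ (0,1]` there is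
`p_iid ∈ [p_ls, α/(d-1)]` with `q(p_iid) = 1` ("Consequently, there exists `p_iid` in this interval such
`q(p_iid) = 1`"; intermediate value theorem, `q(0) = 0`, `q(α/(d-1)) ≥ 1`), and every `0 ≤ p < p_iid` has `q(p) < 1`
("any `p < p_iid` leads to a `q < 1`"; strict monotonicity). The inclusion `p_iid ≥ p_ls` is the text's "It is simple
to see that choosing `p < p_ls` leads to `q < 1`": `q(p) ≤ p^α e^{h} K = (p/p_ls)^α`.
[cite: FawziGrospellierLeverrier2018, Lemma 29 (§7.2, arXiv v2 p0020 L52-66) and Thm 17 discussion (§4, p0013 L33-35)] -/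
theorem fgl18_lemma29 {d : ℕ} (hd : 3 ≤ d) {α : ℝ} (hα0 : 0 < α) (hα1 : α ≤ 1) :
    ∃ piid : ℝ, percolationValue d α ≤ piid ∧ piid ≤ α / ((d : ℝ) - 1) ∧
      (1 - piid) ^ ((d : ℝ) - 1 - α) * piid ^ α * Real.exp (Real.binEntropy α)
          * (((d : ℝ) - 1) * (1 + 1 / ((d : ℝ) - 2)) ^ (d - 2)) = 1 ∧
      ∀ p : ℝ, 0 ≤ p → p < piid →
        (1 - p) ^ ((d : ℝ) - 1 - α) * p ^ α * Real.exp (Real.binEntropy α)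
          * (((d : ℝ) - 1) * (1 + 1 / ((d : ℝ) - 2)) ^ (d - 2)) < 1 := by
  set K : ℝ := ((d : ℝ) - 1) * (1 + 1 / ((d : ℝ) - 2)) ^ (d - 2) with hKdef
  set q : ℝ → ℝ := fun p => (1 - p) ^ ((d : ℝ) - 1 - α) * p ^ α * Real.exp (Real.binEntropy α) * K
    with hqdef
  have hd' : (3 : ℝ) ≤ d := by exact_mod_cast hd
  have hd1 : (0 : ℝ) < (d : ℝ) - 1 := by linarith
  have hK0 : 0 < K := by
    have h2 : (0 : ℝ) < (d : ℝ) - 2 := by linarith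
    rw [hKdef]; positivity
  have hm0 : 0 ≤ (d : ℝ) - 1 - α := by linarith
  have htop0 : 0 ≤ α / ((d : ℝ) - 1) := div_nonneg hα0.le hd1.le
  have htop : α / ((d : ℝ) - 1) ≤ 1 / 2 := by rw [div_le_iff₀ hd1]; linarith
  -- continuity and the intermediate value theorem on `[0, α/(d-1)]`
  have hcont : Continuous q := by
    rw [hqdef]
    refine ((Continuous.mul ?_ (Real.continuous_rpow_const hα0.le)).mul continuous_const).mul
      continuous_const
    exact (Real.continuous_rpow_const hm0).comp (continuous_const.sub continuous_id)
  have hq0 : q 0 = 0 := by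
    show (1 - (0 : ℝ)) ^ ((d : ℝ) - 1 - α) * (0 : ℝ) ^ α * Real.exp (Real.binEntropy α) * K = 0
    rw [Real.zero_rpow hα0.ne']; ring
  have hq1 : 1 ≤ q (α / ((d : ℝ) - 1)) := fgl18_lemma29_endpoint hd hα0 hα1
  have hivt := intermediate_value_Icc htop0 hcont.continuousOn
  obtain ⟨piid, hpiid, hqpiid⟩ := hivt ⟨by rw [hq0]; exact zero_le_one, hq1⟩
  rw [Set.mem_Icc] at hpiid
  have hmono := fgl18_lemma29_strictMonoOn hd hα0 hα1
  have hbelow : ∀ p : ℝ, 0 ≤ p → p < piid → q p < 1 := by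
    intro p hp0 hlt
    rw [← hqpiid]
    exact hmono ⟨hp0, (hlt.le.trans hpiid.2)⟩ ⟨hpiid.1, hpiid.2⟩ hlt
  refine ⟨piid, ?_, hpiid.2, hqpiid, hbelow⟩
  -- `p_ls ≤ p_iid`: otherwise `q(p_iid) ≤ (p_iid/p_ls)^α < 1`
  by_contra hlt
  push Not at hlt
  have hpls0 : 0 < percolationValue d α := by
    rw [percolationValue, ← hKdef]; positivity
  have hplsα : percolationValue d α ^ α = Real.exp (-Real.binEntropy α) / K := by
    rw [hKdef]; exact percolationValue_rpow hd hα0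
  have hbound : q piid ≤ (piid / percolationValue d α) ^ α := by
    show (1 - piid) ^ ((d : ℝ) - 1 - α) * piid ^ α * Real.exp (Real.binEntropy α) * K
        ≤ (piid / percolationValue d α) ^ α
    rw [Real.div_rpow hpiid.1 hpls0.le, hplsα, Real.exp_neg]
    have hle1 : (1 - piid) ^ ((d : ℝ) - 1 - α) ≤ 1 := Real.rpow_le_one (by linarith) (by linarith) hm0
    have hpos : 0 ≤ piid ^ α * Real.exp (Real.binEntropy α) * K :=
      mul_nonneg (mul_nonneg (Real.rpow_nonneg hpiid.1 _) (Real.exp_pos _).le) hK0.le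
    rw [show piid ^ α / ((Real.exp (Real.binEntropy α))⁻¹ / K) = 1 * (piid ^ α * Real.exp (Real.binEntropy α) * K) by
      field_simp]
    calc (1 - piid) ^ ((d : ℝ) - 1 - α) * piid ^ α * Real.exp (Real.binEntropy α) * K
        = (1 - piid) ^ ((d : ℝ) - 1 - α) * (piid ^ α * Real.exp (Real.binEntropy α) * K) := by ring
      _ ≤ 1 * (piid ^ α * Real.exp (Real.binEntropy α) * K) := mul_le_mul_of_nonneg_right hle1 hpos
  have hlt1 : (piid / percolationValue d α) ^ α < 1 :=
    Real.rpow_lt_one (div_nonneg hpiid.1 hpls0.le) ((div_lt_one hpls0).2 hlt) hα0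
  rw [hqpiid] at hbound
  linarith

open Classical in
/-- **Theorem 17 with the independent threshold** (eq. (probiid) ∘ Lemma 29): for `d ≥ 3`, `α ∈ (0,1]` there is
`p_iid ∈ [p_ls, α/(d-1)]` (`q(p_iid) = 1`) such that for EVERY graph of degree `≤ d`, every `t ≥ 1` and every
`0 < p < p_iid`, `q(p) < 1` and `P_iid[MaxConn_α(E) ≥ t] ≤ |V| ((d-1)/(d-2))² q(p)^t/(1-q(p))` — "there is a value
`p_iid ∈ [p_ls, α/(d-1)]` such that `q = 1` and any `p < p_iid` leads to a `q < 1`", so "the size of the largest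
component will be `O(log |V|)` with high probability". [cite: FawziGrospellierLeverrier2018, Thm 17 eq. (probiid) and the paragraph after it (§4, arXiv v2 p0013 L25-35); Lemma 29 (§7.2, p0020)] -/
theorem fgl18_theorem17_iid_threshold {d : ℕ} (hd : 3 ≤ d) {α : ℝ} (hα0 : 0 < α) (hα1 : α ≤ 1) :
    ∃ piid : ℝ, percolationValue d α ≤ piid ∧ piid ≤ α / ((d : ℝ) - 1) ∧
      (1 - piid) ^ ((d : ℝ) - 1 - α) * piid ^ α * Real.exp (Real.binEntropy α)
          * (((d : ℝ) - 1) * (1 + 1 / ((d : ℝ) - 2)) ^ (d - 2)) = 1 ∧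
      ∀ (V : Type) [Fintype V] [DecidableEq V] (G : SimpleGraph V) [DecidableRel G.Adj],
        (∀ v : V, G.degree v ≤ d) → ∀ (t : ℕ), 1 ≤ t → ∀ (p : ℝ), 0 < p → p < piid →
          (1 - p) ^ ((d : ℝ) - 1 - α) * p ^ α * Real.exp (Real.binEntropy α)
              * (((d : ℝ) - 1) * (1 + 1 / ((d : ℝ) - 2)) ^ (d - 2)) < 1 ∧
          ∑ E ∈ univ.filter (fun E => HasAlphaCluster G α t E), bernoulliWeight p E
            ≤ (Fintype.card V : ℝ) * (((d : ℝ) - 1) / ((d : ℝ) - 2)) ^ 2 *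
              (((1 - p) ^ ((d : ℝ) - 1 - α) * p ^ α * Real.exp (Real.binEntropy α)
                  * (((d : ℝ) - 1) * (1 + 1 / ((d : ℝ) - 2)) ^ (d - 2))) ^ t
              / (1 - (1 - p) ^ ((d : ℝ) - 1 - α) * p ^ α * Real.exp (Real.binEntropy α)
                  * (((d : ℝ) - 1) * (1 + 1 / ((d : ℝ) - 2)) ^ (d - 2)))) := by
  obtain ⟨piid, hls, htop, hq1, hbelow⟩ := fgl18_lemma29 hd hα0 hα1
  refine ⟨piid, hls, htop, hq1, ?_⟩
  intro V _ _ G _ hdeg t ht p hp0 hp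
  have hq : _ := hbelow p hp0.le hp
  exact ⟨hq, fgl18_theorem17_iid G hd hdeg hα0 hα1 ht hp0 (lt_of_lt_of_le hp htop) hq⟩

end Lemma29

end Literature.InformationTheory.QuantumCodes
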